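import Summits.KontsevichZagierPeriods.KontsevichZagierPeriods.Theorems.TerasomaMultiplicationCompleteModGammaSectorStubStokesBoxAlg
import Summits.KontsevichZagierPeriods.KontsevichZagierPeriods.Theorems.TerasomaMultiplicationCompleteModGammaSectorTransportOfStokesBox
import Summits.KontsevichZagierPeriods.KontsevichZagierPeriods.Theorems.TerasomaMultiplicationBetaCancellationEulerIntervals

/-!
# `CompleteModGammaSector` (stmt-KontsevichZagierPeriods-14233) — shared ENGINE of the lines
`cusp-transport-to-the-beta-world` / `hodge-locus-cobordism`: certificate transport, UNCONDITIONAL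

The registered engine stubs E2' `stub_certificateTransport` (band form) and E2
`stub_divergenceCertificateTransport` (closed-box form), and the old reduction stub
`divergenceCertificateTransport_of_stokesBoxAlg`, all now ONE-LINERS: E2' is the landed reduction
`certificateTransport_of_stokesBoxBand` (p98362) applied to the landed box-Stokes move
`stub_stokesBoxBand` (p97826); E2 weakens E2' by `IsSemialgebraicFunOn.mono` (its semialgebraicity
hypotheses are on larger sets); the old reduction ignores its hypothesis.

**What this gives** (Kontsevich–Zagier 2001, §1.2, rules (1)–(3) only): for a one-parameter
family of integrands `x ↦ F(x, s)` on the open unit box whose `s`-derivative is a divergence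
`Σᵢ ∂Gᵢ/∂xᵢ` with potentials `Gᵢ` vanishing on the faces `xᵢ ∈ {0,1}`, the end fibres
`[box, F(·,t₀)]`, `[box, F(·,t₁)]` (real algebraic `t₀ < t₁`) are KZ-equivalent. Instances: Legendre's
modulus propagation (GaussManinCertificates `LegendreModulusPropagation`, n = 2), the cusp transport
of the Elliott family (card cusp-transport-to-the-beta-world), Hodge-locus transports (card
hodge-locus-cobordism).
-/

noncomputable section

-- `Summit.KontsevichZagierPeriods.KontsevichZagierPeriods.…` is the tree's mandated layout (single-conjunct summit).
set_option linter.dupNamespace false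

namespace Summit.KontsevichZagierPeriods.KontsevichZagierPeriods.CompleteModGammaSectorEngine

open MeasureTheory Set
open Literature.NumberTheory.Transcendental
open Literature.NumberTheory.Transcendental.KZ
open Literature.ModelTheory.ExponentialFields (IsSemialgebraic)

/-- The parameter band `(0,1)ⁿ × [t₀, t₁]` (open in `x`, closed in the parameter) is
`ℚ`-semialgebraic for real algebraic `t₀, t₁`. [folklore] -/
theorem isSemialgebraic_paramBand {n : ℕ} {t₀ t₁ : ℝ} (h₀ : IsAlgebraic ℚ t₀) (h₁ : IsAlgebraic ℚ t₁) :
    IsSemialgebraic ℚ {z : Fin (n + 1) → ℝ | (∀ i : Fin n, z (Fin.castSucc i) ∈ Set.Ioo (0:ℝ) 1) ∧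
      z (Fin.last n) ∈ Set.Icc t₀ t₁} := by
  have h1 : IsSemialgebraic ℚ {z : Fin (n + 1) → ℝ | ∀ i : Fin n, z (Fin.castSucc i) ∈ Set.Ioo (0:ℝ) 1} := by
    have h : {z : Fin (n + 1) → ℝ | ∀ i : Fin n, z (Fin.castSucc i) ∈ Set.Ioo (0:ℝ) 1} =
        ⋂ i ∈ (Finset.univ : Finset (Fin n)), ({z | (0:ℝ) < z (Fin.castSucc i)} ∩
          {z | z (Fin.castSucc i) < (1:ℝ)}) := by
      ext z
      simp
    rw [h]
    exact IsSemialgebraic.biInter _ _ fun i _ =>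
      (isSemialgebraic_setOf_const_lt_apply isAlgebraic_zero _).inter
        (isSemialgebraic_setOf_apply_lt_const isAlgebraic_one _)
  convert h1.inter ((BetaCancellationLine.isSemialgebraic_setOf_const_le h₀ (Fin.last n)).inter
    (BetaCancellationLine.isSemialgebraic_setOf_le_const h₁ (Fin.last n))) using 1
  ext z
  simp only [mem_setOf_eq, mem_inter_iff, mem_Icc]

/-- The potential band for direction `i`: open in every coordinate except `xᵢ ∈ [0,1]`, the
parameter in `(t₀, t₁)`; `ℚ`-semialgebraic for real algebraic `t₀, t₁`. [folklore] -/
theorem isSemialgebraic_potentialBand {n : ℕ} {t₀ t₁ : ℝ} (h₀ : IsAlgebraic ℚ t₀) (h₁ : IsAlgebraic ℚ t₁)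
    (i : Fin n) :
    IsSemialgebraic ℚ {z : Fin (n + 1) → ℝ | (∀ j : Fin n, j ≠ i → z (Fin.castSucc j) ∈ Set.Ioo (0:ℝ) 1) ∧
      z (Fin.castSucc i) ∈ Set.Icc (0:ℝ) 1 ∧ z (Fin.last n) ∈ Set.Ioo t₀ t₁} := by
  classical
  have h1 : IsSemialgebraic ℚ {z : Fin (n + 1) → ℝ | ∀ j : Fin n, j ≠ i →
      z (Fin.castSucc j) ∈ Set.Ioo (0:ℝ) 1} := by
    have h : {z : Fin (n + 1) → ℝ | ∀ j : Fin n, j ≠ i → z (Fin.castSucc j) ∈ Set.Ioo (0:ℝ) 1} =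
        ⋂ j ∈ (Finset.univ.filter fun j : Fin n => j ≠ i), ({z | (0:ℝ) < z (Fin.castSucc j)} ∩
          {z | z (Fin.castSucc j) < (1:ℝ)}) := by
      ext z
      simp
    rw [h]
    exact IsSemialgebraic.biInter _ _ fun j _ =>
      (isSemialgebraic_setOf_const_lt_apply isAlgebraic_zero _).inter
        (isSemialgebraic_setOf_apply_lt_const isAlgebraic_one _)
  convert h1.inter (((BetaCancellationLine.isSemialgebraic_setOf_const_le isAlgebraic_zero (Fin.castSucc i)).inter
    (BetaCancellationLine.isSemialgebraic_setOf_le_const isAlgebraic_one (Fin.castSucc i))).inter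
    ((isSemialgebraic_setOf_const_lt_apply h₀ (Fin.last n)).inter
      (isSemialgebraic_setOf_apply_lt_const h₁ (Fin.last n)))) using 1
  ext z
  simp only [mem_setOf_eq, mem_inter_iff, mem_Icc, mem_Ioo]

/-- **Registered engine stub E2' `stub_certificateTransport`** (band form): divergence-certificate
transport in the parameter is a chain of moves — reduction `certificateTransport_of_stokesBoxBand`
applied to the box-Stokes move `stub_stokesBoxBand`. [cite: KontsevichZagier2001, §1.2] -/
theorem stub_certificateTransport :
    ∀ (n : ℕ) (t₀ t₁ : ℝ) (F : (Fin (n + 1) → ℝ) → ℝ) (g G : Fin n → (Fin (n + 1) → ℝ) → ℝ)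
      (r₀ r₁ : IntegralRep n),
      t₀ < t₁ → IsAlgebraic ℚ t₀ → IsAlgebraic ℚ t₁ →
      IsSemialgebraicFunOn ℚ {z | (∀ i : Fin n, z (Fin.castSucc i) ∈ Set.Ioo (0:ℝ) 1) ∧
        z (Fin.last n) ∈ Set.Icc t₀ t₁} F →
      (∀ i, IsSemialgebraicFunOn ℚ {z | (∀ j : Fin n, j ≠ i → z (Fin.castSucc j) ∈ Set.Ioo (0:ℝ) 1) ∧
        z (Fin.castSucc i) ∈ Set.Icc (0:ℝ) 1 ∧ z (Fin.last n) ∈ Set.Ioo t₀ t₁} (G i)) →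
      (∀ i, IsSemialgebraicFunOn ℚ {z | (∀ j : Fin n, z (Fin.castSucc j) ∈ Set.Ioo (0:ℝ) 1) ∧
        z (Fin.last n) ∈ Set.Ioo t₀ t₁} (g i)) →
      (∀ i, IntegrableOn (g i) {z | (∀ j : Fin n, z (Fin.castSucc j) ∈ Set.Ioo (0:ℝ) 1) ∧
        z (Fin.last n) ∈ Set.Ioo t₀ t₁}) →
      (∀ x : Fin n → ℝ, (∀ i, x i ∈ Set.Ioo (0:ℝ) 1) →
        ContinuousOn (fun s : ℝ => F (Fin.snoc x s)) (Set.Icc t₀ t₁) ∧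
        ∀ s ∈ Set.Ioo t₀ t₁, HasDerivAt (fun u : ℝ => F (Fin.snoc x u)) (∑ i, g i (Fin.snoc x s)) s) →
      (∀ (i : Fin n) (z : Fin (n + 1) → ℝ), ((∀ j : Fin n, z (Fin.castSucc j) ∈ Set.Ioo (0:ℝ) 1) ∧
          z (Fin.last n) ∈ Set.Ioo t₀ t₁) →
        ContinuousOn (fun u : ℝ => G i (Function.update z (Fin.castSucc i) u)) (Set.Icc (0:ℝ) 1) ∧
        G i (Function.update z (Fin.castSucc i) 0) = 0 ∧ G i (Function.update z (Fin.castSucc i) 1) = 0 ∧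
        ∀ u ∈ Set.Ioo (0:ℝ) 1, HasDerivAt (fun v : ℝ => G i (Function.update z (Fin.castSucc i) v))
          (g i (Function.update z (Fin.castSucc i) u)) u) →
      r₀.domain = {x | ∀ i, x i ∈ Set.Ioo (0:ℝ) 1} →
      Set.EqOn r₀.integrand (fun x => F (Fin.snoc x t₀)) r₀.domain →
      r₁.domain = {x | ∀ i, x i ∈ Set.Ioo (0:ℝ) 1} →
      Set.EqOn r₁.integrand (fun x => F (Fin.snoc x t₁)) r₁.domain →
      Equivalent r₀ r₁ :=
  certificateTransport_of_stokesBoxBand stub_stokesBoxBand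

/-- **Registered engine stub E2 `stub_divergenceCertificateTransport`** (closed-box form): the same
with the semialgebraicity of `F` and of the potentials `Gᵢ` assumed on the closed band / closed box;
follows from E2' by restriction (`IsSemialgebraicFunOn.mono`). [cite: KontsevichZagier2001, §1.2] -/
theorem stub_divergenceCertificateTransport :
    ∀ (n : ℕ) (t₀ t₁ : ℝ) (F : (Fin (n + 1) → ℝ) → ℝ) (g G : Fin n → (Fin (n + 1) → ℝ) → ℝ)
      (r₀ r₁ : IntegralRep n),
      t₀ < t₁ → IsAlgebraic ℚ t₀ → IsAlgebraic ℚ t₁ →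
      IsSemialgebraicFunOn ℚ {z | (∀ i : Fin n, z (Fin.castSucc i) ∈ Set.Icc (0:ℝ) 1) ∧
        z (Fin.last n) ∈ Set.Icc t₀ t₁} F →
      (∀ i, IsSemialgebraicFunOn ℚ {z | (∀ j : Fin n, z (Fin.castSucc j) ∈ Set.Icc (0:ℝ) 1) ∧
        z (Fin.last n) ∈ Set.Icc t₀ t₁} (G i)) →
      (∀ i, IsSemialgebraicFunOn ℚ {z | (∀ j : Fin n, z (Fin.castSucc j) ∈ Set.Ioo (0:ℝ) 1) ∧
        z (Fin.last n) ∈ Set.Ioo t₀ t₁} (g i)) →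
      (∀ i, IntegrableOn (g i) {z | (∀ j : Fin n, z (Fin.castSucc j) ∈ Set.Ioo (0:ℝ) 1) ∧
        z (Fin.last n) ∈ Set.Ioo t₀ t₁}) →
      (∀ x : Fin n → ℝ, (∀ i, x i ∈ Set.Ioo (0:ℝ) 1) →
        ContinuousOn (fun s : ℝ => F (Fin.snoc x s)) (Set.Icc t₀ t₁) ∧
        ∀ s ∈ Set.Ioo t₀ t₁, HasDerivAt (fun u : ℝ => F (Fin.snoc x u)) (∑ i, g i (Fin.snoc x s)) s) →
      (∀ (i : Fin n) (z : Fin (n + 1) → ℝ), ((∀ j : Fin n, z (Fin.castSucc j) ∈ Set.Ioo (0:ℝ) 1) ∧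
          z (Fin.last n) ∈ Set.Ioo t₀ t₁) →
        ContinuousOn (fun u : ℝ => G i (Function.update z (Fin.castSucc i) u)) (Set.Icc (0:ℝ) 1) ∧
        G i (Function.update z (Fin.castSucc i) 0) = 0 ∧ G i (Function.update z (Fin.castSucc i) 1) = 0 ∧
        ∀ u ∈ Set.Ioo (0:ℝ) 1, HasDerivAt (fun v : ℝ => G i (Function.update z (Fin.castSucc i) v))
          (g i (Function.update z (Fin.castSucc i) u)) u) →
      r₀.domain = {x | ∀ i, x i ∈ Set.Ioo (0:ℝ) 1} →
      Set.EqOn r₀.integrand (fun x => F (Fin.snoc x t₀)) r₀.domain →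
      r₁.domain = {x | ∀ i, x i ∈ Set.Ioo (0:ℝ) 1} →
      Set.EqOn r₁.integrand (fun x => F (Fin.snoc x t₁)) r₁.domain →
      Equivalent r₀ r₁ := by
  intro n t₀ t₁ F g G r₀ r₁ ht h₀ h₁ hF hG hg hgi hFd hGd hr₀d hr₀i hr₁d hr₁i
  refine stub_certificateTransport n t₀ t₁ F g G r₀ r₁ ht h₀ h₁ ?_ (fun i => ?_) hg hgi hFd hGd hr₀d
    hr₀i hr₁d hr₁i
  · refine hF.mono (fun z hz => ⟨fun i => Ioo_subset_Icc_self (hz.1 i), hz.2⟩) ?_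
    exact isSemialgebraic_paramBand h₀ h₁
  · refine (hG i).mono (fun z hz => ⟨fun j => ?_, Ioo_subset_Icc_self hz.2.2⟩) ?_
    · by_cases hji : j = i
      · subst hji; exact hz.2.1
      · exact Ioo_subset_Icc_self (hz.1 j hji)
    · exact isSemialgebraic_potentialBand h₀ h₁ i

/-- The old registered reduction `divergenceCertificateTransport_of_stokesBoxAlg` (E1 → E2), now
trivial: E2 holds unconditionally. [cite: KontsevichZagier2001, §1.2] -/
theorem divergenceCertificateTransport_of_stokesBoxAlg :
    (∀ (n : ℕ) (a b : Fin (n + 1) → ℝ) (r : IntegralRep (n + 1)) (H : (Fin (n + 1) → ℝ) → ℝ), (∀ i, a i < b i) → (∀ i, IsAlgebraic ℚ (a i)) → (∀ i, IsAlgebraic ℚ (b i)) → r.domain = {z | ∀ i, z i ∈ Set.Ioo (a i) (b i)} → IsSemialgebraicFunOn ℚ {z | ∀ i, z i ∈ Set.Icc (a i) (b i)} H → (∀ x : Fin n → ℝ, (∀ i, x i ∈ Set.Ioo (a (Fin.castSucc i)) (b (Fin.castSucc i))) → ContinuousOn (fun s : ℝ => H (Fin.snoc x s)) (Set.Icc (a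 (Fin.last n)) (b (Fin.last n))) ∧ H (Fin.snoc x (a (Fin.last n))) = 0 ∧ H (Fin.snoc x (b (Fin.last n))) = 0 ∧ ∀ t ∈ Set.Ioo (a (Fin.last n)) (b (Fin.last n)), HasDerivAt (fun s : ℝ => H (Fin.snoc x s)) (r.integrand (Fin.snoc x t)) t) → of r ∈ relations) →

    ∀ (n : ℕ) (t₀ t₁ : ℝ) (F : (Fin (n + 1) → ℝ) → ℝ) (g G : Fin n → (Fin (n + 1) → ℝ) → ℝ)
      (r₀ r₁ : IntegralRep n),
      t₀ < t₁ → IsAlgebraic ℚ t₀ → IsAlgebraic ℚ t₁ →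
      IsSemialgebraicFunOn ℚ {z | (∀ i : Fin n, z (Fin.castSucc i) ∈ Set.Icc (0:ℝ) 1) ∧
        z (Fin.last n) ∈ Set.Icc t₀ t₁} F →
      (∀ i, IsSemialgebraicFunOn ℚ {z | (∀ j : Fin n, z (Fin.castSucc j) ∈ Set.Icc (0:ℝ) 1) ∧
        z (Fin.last n) ∈ Set.Icc t₀ t₁} (G i)) →
      (∀ i, IsSemialgebraicFunOn ℚ {z | (∀ j : Fin n, z (Fin.castSucc j) ∈ Set.Ioo (0:ℝ) 1) ∧
        z (Fin.last n) ∈ Set.Ioo t₀ t₁} (g i)) →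
      (∀ i, IntegrableOn (g i) {z | (∀ j : Fin n, z (Fin.castSucc j) ∈ Set.Ioo (0:ℝ) 1) ∧
        z (Fin.last n) ∈ Set.Ioo t₀ t₁}) →
      (∀ x : Fin n → ℝ, (∀ i, x i ∈ Set.Ioo (0:ℝ) 1) →
        ContinuousOn (fun s : ℝ => F (Fin.snoc x s)) (Set.Icc t₀ t₁) ∧
        ∀ s ∈ Set.Ioo t₀ t₁, HasDerivAt (fun u : ℝ => F (Fin.snoc x u)) (∑ i, g i (Fin.snoc x s)) s) →
      (∀ (i : Fin n) (z : Fin (n + 1) → ℝ), ((∀ j : Fin n, z (Fin.castSucc j) ∈ Set.Ioo (0:ℝ) 1) ∧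
          z (Fin.last n) ∈ Set.Ioo t₀ t₁) →
        ContinuousOn (fun u : ℝ => G i (Function.update z (Fin.castSucc i) u)) (Set.Icc (0:ℝ) 1) ∧
        G i (Function.update z (Fin.castSucc i) 0) = 0 ∧ G i (Function.update z (Fin.castSucc i) 1) = 0 ∧
        ∀ u ∈ Set.Ioo (0:ℝ) 1, HasDerivAt (fun v : ℝ => G i (Function.update z (Fin.castSucc i) v))
          (g i (Function.update z (Fin.castSucc i) u)) u) →
      r₀.domain = {x | ∀ i, x i ∈ Set.Ioo (0:ℝ) 1} →
      Set.EqOn r₀.integrand (fun x => F (Fin.snoc x t₀)) r₀.domain →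
      r₁.domain = {x | ∀ i, x i ∈ Set.Ioo (0:ℝ) 1} →
      Set.EqOn r₁.integrand (fun x => F (Fin.snoc x t₁)) r₁.domain →
      Equivalent r₀ r₁ :=
  fun _ => stub_divergenceCertificateTransport

end Summit.KontsevichZagierPeriods.KontsevichZagierPeriods.CompleteModGammaSectorEngine
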